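import Summits.FinalStateConjecture.FinalStateConjecture.Theorems.LogTimeThreeAnnuliDyadicCaptureFreezingC

/-!
# Route LogTimeThreeAnnuli · crux `DyadicCapture` · line `registered` — freezing assembly, part D

THE TELESCOPING JET BOUNDS of `stub_freezingAssembly`. For one instance `(k, ρ)` — window members
`pₙ → p∞` with finite window errors `eₙ = sup_{τ ∈ Iₙ} (δᵏ_ρ + δᵏ_{R τ})(τ; pₙ)`,
`Iₙ = [2^(n₀+n), 2^(n₀+n+1)]`, tails `Tₙ = Σⱼ e_{j+n}` — on the reference exterior of a smooth chart:

* `freezing_jet_sub_limit_le`: at every point `y` of the fixed slab of radius `ρ` (any time) the jets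
  of the members form a sequence with `‖Dᵐ g_{pⱼ}(y) − Dᵐ g_{pⱼ₊₁}(y)‖ ≤ eⱼ + eⱼ₊₁` (move `y` along
  the Killing orbit into the slab at the shared endpoint `2^(n₀+j+1)`, `freezing_add_smul_mem_slab`,
  `freezing_iteratedFDeriv_boosted_sub_add_smul`, then the smooth triangle inequality of part A), so
  by part C and jet continuity (`stub_kerrSchildJets` (i)) `‖Dᵐ g_{pₙ}(y) − Dᵐ g_{p∞}(y)‖ ≤ 2Tₙ`;
* `freezing_fixed_pointwise`: hence `‖Dᵐ(Ψ^*g − g_{p∞})(y)‖ ≤ eₙ + 2Tₙ ≤ 3Tₙ` for `y` in the slab at a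
  time `τ ∈ Iₙ`;
* `freezing_far_pointwise`: at points of rest-frame spatial norm `≥ s` with `s² ≥ R₀² + (|χ|/m₀)²`
  every member is `C/R₀`-close to `η` in `Cᵐ` (`stub_kerrSchildJets` (ii), uniform on the window),
  so `‖Dᵐ(Ψ^*g − g_{p∞})(y)‖ ≤ eₙ + 2C/R₀` on the growing slab at a time `τ ∈ Iₙ`.

All discs stay out of the exterior (`freezing_sq_le_of_truncDeviationCk_ne_top`, passed to the limit
in `freezing_sq_le_of_tendsto`), which is what makes every member smooth at slab points.
Sources: Simon, Ann. Math. 118 (1983) (the scheme); Kerr–Schild 1965 §2–3.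
-/

-- the `Summit.FinalStateConjecture.FinalStateConjecture.…` namespace repeats the summit = sub-problem
-- segment (D-0017 layout, CONVENTIONS §2); the duplicate is deliberate.
set_option linter.dupNamespace false

noncomputable section

namespace Summit.FinalStateConjecture.FinalStateConjecture.Theorems

open Literature.Geometry.Lorentzian
open scoped Topology Manifold ENNReal ContDiff
open Filter Set

/-! ### Small facts -/

/-- A closed disc bound passes to the limit of the spin parameters. [folklore] -/
theorem freezing_sq_le_of_tendsto {p : ℕ → ℝ × ℝ} {pinf : ℝ × ℝ} {A2 : ℝ} (h : ∀ n, (p n).2 ^ 2 ≤ A2)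
    (hp : Tendsto p atTop (𝓝 pinf)) : pinf.2 ^ 2 ≤ A2 :=
  le_of_tendsto ((continuous_snd.pow 2).continuousAt.tendsto.comp hp) (Eventually.of_forall h)

/-- Window members have `|a| ≤ |χ|/m₀`. [folklore] -/
theorem freezing_abs_le_of_window {m₀ χ : ℝ} (hm₀ : 0 < m₀) {q : ℝ × ℝ}
    (hq : q ∈ {q : ℝ × ℝ | m₀ ≤ q.1 ∧ q.1 ≤ m₀⁻¹ ∧ |q.2| ≤ χ * q.1}) : |q.2| ≤ |χ| * m₀⁻¹ := by
  obtain ⟨h1, h2, h3⟩ := hq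
  have hM : 0 ≤ q.1 := hm₀.le.trans h1
  calc |q.2| ≤ χ * q.1 := h3
    _ ≤ |χ| * q.1 := mul_le_mul_of_nonneg_right (le_abs_self χ) hM
    _ ≤ |χ| * m₀⁻¹ := mul_le_mul_of_nonneg_left h2 (abs_nonneg χ)

/-- **Uniform far-field decay up to order `k`**: one pair `(C, R₀)` serving every `m ≤ k`
(`stub_kerrSchildJets` (ii), maxima over `m ≤ k`). [cite: KerrSchild1965, §3] -/
theorem freezing_decay_uniform (Λ : lorentzGroup) (c : E4) {m₀ : ℝ} (χ : ℝ) (hm₀ : 0 < m₀) (k : ℕ) :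
    ∃ C R₀ : ℝ, 0 < R₀ ∧ ∀ m ≤ k, ∀ (M a : ℝ), m₀ ≤ M → M ≤ m₀⁻¹ → |a| ≤ χ * M → ∀ x : E4,
      R₀ ≤ Kerr.radius a (poincareInv Λ c x) →
      ‖iteratedFDeriv ℝ m (fun y ↦ boostedKerrBilin Λ c M a y - Minkowski.bilin) x‖ ≤
        C / Kerr.radius a (poincareInv Λ c x) := by
  induction k with
  | zero =>
    obtain ⟨C, R₀, hR₀, h⟩ := stub_kerrSchildJets.2 Λ c 0 m₀ χ hm₀
    exact ⟨C, R₀, hR₀, fun m hm ↦ by rw [Nat.le_zero.1 hm]; exact h⟩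
  | succ k ih =>
    obtain ⟨C, R₀, hR₀, h⟩ := ih
    obtain ⟨C', R₀', hR₀', h'⟩ := stub_kerrSchildJets.2 Λ c (k + 1) m₀ χ hm₀
    refine ⟨max C C', max R₀ R₀', lt_max_of_lt_left hR₀, fun m hm M a hM1 hM2 ha x hx ↦ ?_⟩
    have hr : 0 < Kerr.radius a (poincareInv Λ c x) := hR₀.trans_le ((le_max_left _ _).trans hx)
    rcases Nat.of_le_succ hm with hmk | hmk
    · exact (h m hmk M a hM1 hM2 ha x ((le_max_left _ _).trans hx)).trans
        (div_le_div_of_nonneg_right (le_max_left _ _) hr.le)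
    · rw [hmk]
      exact (h' M a hM1 hM2 ha x ((le_max_right _ _).trans hx)).trans
        (div_le_div_of_nonneg_right (le_max_right _ _) hr.le)

/-! ### One instance: the telescoping jet bounds -/

section Instance

variable {𝓢 : Spacetime.{0} 4} (Λ : lorentzGroup) (c : E4) (M' a' : ℝ)
  (Ψ : (boostedKerrExterior Λ c M' a') → 𝓢.carrier)

set_option quotPrecheck false in
set_option hygiene false in
/-- The window background of the member `p` over the reference boosted exterior (notation). -/
local notation "Bw⟦" p "⟧" =>
  ({boostedKerrBackground Λ c M' a' with bilin := boostedKerrBilin Λ c (Prod.fst p) (Prod.snd p)} :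
    ModelBackground)

set_option quotPrecheck false in
set_option hygiene false in
/-- The window error of the member `q` on the `n`-th dyadic window (notation). -/
local notation "Ew⟦" R "," k "," ρ "," n₀ "," n "," q "⟧" =>
  (⨆ τ ∈ Set.Icc ((2 : ℝ) ^ (n₀ + n)) ((2 : ℝ) ^ (n₀ + n + 1)),
    (Spacetime.truncDeviationCk 𝓢 Bw⟦q⟧ Ψ k ρ τ + Spacetime.truncDeviationCk 𝓢 Bw⟦q⟧ Ψ k (R τ) τ))

/-- Pointwise bound from the window error, fixed slab: for `τ ∈ Iₙ`, `y` in the slab of radius `ρ`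
at time `τ` and `m ≤ k`, `‖Dᵐ(Ψ^*g − g_q)(y)‖ ≤ eₙ(q)`. [folklore] -/
theorem freezing_window_pointwise_fixed (R : ℝ → ℝ) {k m : ℕ} (hm : m ≤ k) (ρ : ℝ) (n₀ n : ℕ)
    (q : ℝ × ℝ) {τ : ℝ} (hτ : τ ∈ Set.Icc ((2 : ℝ) ^ (n₀ + n)) ((2 : ℝ) ^ (n₀ + n + 1))) {y : E4}
    (hy : y ∈ Subtype.val '' (Bw⟦q⟧).truncTimeSlab ρ τ) :
    ‖iteratedFDeriv ℝ m (𝓢.deviationExtend Bw⟦q⟧ Ψ) y‖ₑ ≤ Ew⟦R, k, ρ, n₀, n, q⟧ := by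
  refine (freezing_enorm_iteratedFDeriv_le_truncDeviationCk (𝓢 := 𝓢) (boostedKerrBackground Λ c M' a') Ψ
    (boostedKerrBilin Λ c q.1 q.2) hm hy).trans ?_
  exact le_iSup₂_of_le (f := fun τ (_ : τ ∈ Set.Icc ((2 : ℝ) ^ (n₀ + n)) ((2 : ℝ) ^ (n₀ + n + 1))) ↦
    Spacetime.truncDeviationCk 𝓢 Bw⟦q⟧ Ψ k ρ τ + Spacetime.truncDeviationCk 𝓢 Bw⟦q⟧ Ψ k (R τ) τ)
    τ hτ le_self_add

/-- Pointwise bound from the window error, growing slab: for `τ ∈ Iₙ`, `y` in the slab of radius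
`R τ` at time `τ` and `m ≤ k`, `‖Dᵐ(Ψ^*g − g_q)(y)‖ ≤ eₙ(q)`. [folklore] -/
theorem freezing_window_pointwise_growing (R : ℝ → ℝ) {k m : ℕ} (hm : m ≤ k) (ρ : ℝ) (n₀ n : ℕ)
    (q : ℝ × ℝ) {τ : ℝ} (hτ : τ ∈ Set.Icc ((2 : ℝ) ^ (n₀ + n)) ((2 : ℝ) ^ (n₀ + n + 1))) {y : E4}
    (hy : y ∈ Subtype.val '' (Bw⟦q⟧).truncTimeSlab (R τ) τ) :
    ‖iteratedFDeriv ℝ m (𝓢.deviationExtend Bw⟦q⟧ Ψ) y‖ₑ ≤ Ew⟦R, k, ρ, n₀, n, q⟧ := by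
  refine (freezing_enorm_iteratedFDeriv_le_truncDeviationCk (𝓢 := 𝓢) (boostedKerrBackground Λ c M' a') Ψ
    (boostedKerrBilin Λ c q.1 q.2) hm hy).trans ?_
  exact le_iSup₂_of_le (f := fun τ (_ : τ ∈ Set.Icc ((2 : ℝ) ^ (n₀ + n)) ((2 : ℝ) ^ (n₀ + n + 1))) ↦
    Spacetime.truncDeviationCk 𝓢 Bw⟦q⟧ Ψ k ρ τ + Spacetime.truncDeviationCk 𝓢 Bw⟦q⟧ Ψ k (R τ) τ)
    τ hτ le_add_self

-- long statements; the algebraic / operator-norm instance paths on `E4 →L[ℝ] E4 →L[ℝ] ℝ` unify slowly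
set_option synthInstance.maxHeartbeats 200000 in
set_option maxHeartbeats 1600000 in
/-- **Jets of the members converge at every point of the fixed slab, quantitatively**: if the
window members `pₙ → p∞` have finite window errors with vanishing tails on the slab of radius `ρ`,
all discs excluded (`(pₙ).2², p∞.2² ≤ a'² + max(r₊',0)²`), then for `y` in the slab of radius `ρ` (at
any time) and `m ≤ k`, `‖Dᵐ g_{pₙ}(y) − Dᵐ g_{p∞}(y)‖ ≤ 2 · Σⱼ e_{j+n}`. [cite: KerrSchild1965, §2] -/
theorem freezing_jet_sub_limit_le (hΨ : ContMDiff 𝓘(ℝ, E4) (𝓡 4) ∞ Ψ) (R : ℝ → ℝ) {k m : ℕ}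
    (hm : m ≤ k) (ρ : ℝ) (n₀ : ℕ) {p : ℕ → ℝ × ℝ} {pinf : ℝ × ℝ}
    (hdisc : ∀ n, (p n).2 ^ 2 ≤ a' ^ 2 + max (Kerr.rPlus M' a') 0 ^ 2)
    (hdisc' : pinf.2 ^ 2 ≤ a' ^ 2 + max (Kerr.rPlus M' a') 0 ^ 2)
    (hp : Tendsto p atTop (𝓝 pinf)) (hfin : ∀ n, Ew⟦R, k, ρ, n₀, n, p n⟧ ≠ ⊤)
    (htail : Tendsto (fun n ↦ ∑' j, Ew⟦R, k, ρ, n₀, j + n, p (j + n)⟧) atTop (𝓝 0))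
    {τ : ℝ} {y : E4} (hy : y ∈ Subtype.val '' (Bw⟦pinf⟧).truncTimeSlab ρ τ) (n : ℕ) :
    ‖iteratedFDeriv ℝ m (boostedKerrBilin Λ c (p n).1 (p n).2) y -
        iteratedFDeriv ℝ m (boostedKerrBilin Λ c pinf.1 pinf.2) y‖ₑ ≤
      2 * ∑' j, Ew⟦R, k, ρ, n₀, j + n, p (j + n)⟧ := by
  have hyU : y ∈ (boostedKerrExterior Λ c M' a' : Set E4) := ((freezing_mem_slab_iff Λ c M' a' _ ρ τ y).1 hy).1
  have hrad : ∀ j, 0 < Kerr.radius (p j).2 (poincareInv Λ c y) := fun j ↦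
    freezing_radius_pos_boosted Λ c (hdisc j) hyU
  have hradinf : 0 < Kerr.radius pinf.2 (poincareInv Λ c y) := freezing_radius_pos_boosted Λ c hdisc' hyU
  -- the window errors of the members
  set e : ℕ → ℝ≥0∞ := fun j ↦ Ew⟦R, k, ρ, n₀, j, p j⟧ with he
  -- consecutive jets are close: move `y` along the orbit into the slab at the shared endpoint
  have hstep : ∀ j, ‖iteratedFDeriv ℝ m (boostedKerrBilin Λ c (p j).1 (p j).2) y -
      iteratedFDeriv ℝ m (boostedKerrBilin Λ c (p (j + 1)).1 (p (j + 1)).2) y‖ₑ ≤ e j + e (j + 1) := by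
    intro j
    set τj : ℝ := (2 : ℝ) ^ (n₀ + j + 1) with hτj
    have hτjj : τj ∈ Set.Icc ((2 : ℝ) ^ (n₀ + j)) ((2 : ℝ) ^ (n₀ + j + 1)) :=
      ⟨pow_le_pow_right₀ one_le_two (Nat.le_succ _), le_rfl⟩
    have hτjj1 : τj ∈ Set.Icc ((2 : ℝ) ^ (n₀ + (j + 1))) ((2 : ℝ) ^ (n₀ + (j + 1) + 1)) :=
      ⟨le_of_eq (by rw [hτj, ← add_assoc]), pow_le_pow_right₀ one_le_two (by omega)⟩
    -- the translate of `y` at time `τj`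
    set yj : E4 := y + (τj - τ) • (Λ : E4 ≃L[ℝ] E4) (EuclideanSpace.single (0 : Fin 4) (1 : ℝ)) with hyj
    have hyjU : yj ∈ (boostedKerrExterior Λ c M' a' : Set E4) :=
      freezing_add_smul_mem_exterior Λ c M' a' hyU _
    have hyj_slab : ∀ q : ℝ × ℝ, yj ∈ Subtype.val '' (Bw⟦q⟧).truncTimeSlab ρ τj := by
      intro q
      have hy' : y ∈ Subtype.val '' (Bw⟦q⟧).truncTimeSlab ρ τ := by
        rw [freezing_mem_slab_iff] at hy ⊢; exact hy
      have := freezing_add_smul_mem_slab Λ c M' a' (boostedKerrBilin Λ c q.1 q.2) hy' (τj - τ)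
      rwa [add_sub_cancel] at this
    have hradj : ∀ i, 0 < Kerr.radius (p i).2 (poincareInv Λ c yj) := fun i ↦
      freezing_radius_pos_boosted Λ c (hdisc i) hyjU
    -- jets of the difference at `y` = at `yj` (stationarity), bounded by the two deviations there
    have hsub : iteratedFDeriv ℝ m (boostedKerrBilin Λ c (p j).1 (p j).2) y -
        iteratedFDeriv ℝ m (boostedKerrBilin Λ c (p (j + 1)).1 (p (j + 1)).2) y =
        iteratedFDeriv ℝ m (fun z ↦ boostedKerrBilin Λ c (p j).1 (p j).2 z -
          boostedKerrBilin Λ c (p (j + 1)).1 (p (j + 1)).2 z) y :=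
      (iteratedFDeriv_sub_apply ((freezing_contDiffAt_boosted Λ c (p j) (hrad j)).of_le (mod_cast le_top))
        ((freezing_contDiffAt_boosted Λ c (p (j + 1)) (hrad (j + 1))).of_le (mod_cast le_top))).symm
    rw [hsub, ← freezing_iteratedFDeriv_boosted_sub_add_smul Λ c (p j) (p (j + 1)) m y (τj - τ)]
    refine (freezing_enorm_iteratedFDeriv_bilin_sub_le (𝓢 := 𝓢) (boostedKerrBackground Λ c M' a') Ψ
      (boostedKerrBilin Λ c (p (j + 1)).1 (p (j + 1)).2) (boostedKerrBilin Λ c (p j).1 (p j).2) hΨ hyjU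
      (freezing_contDiffAt_boosted Λ c (p (j + 1)) (hradj (j + 1)))
      (freezing_contDiffAt_boosted Λ c (p j) (hradj j)) m).trans ?_
    rw [add_comm]
    exact add_le_add (freezing_window_pointwise_fixed Λ c M' a' Ψ R hm ρ n₀ j (p j) hτjj (hyj_slab (p j)))
      (freezing_window_pointwise_fixed Λ c M' a' Ψ R hm ρ n₀ (j + 1) (p (j + 1)) hτjj1 (hyj_slab (p (j + 1))))
  -- hence the jets converge to some limit with the tail bound …
  have hsum : ∑' j, e j ≠ ⊤ := freezing_tsum_ne_top_of_tail hfin htail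
  obtain ⟨Lm, hLm, hbound⟩ := freezing_exists_tendsto_of_le
    (G := fun j ↦ iteratedFDeriv ℝ m (boostedKerrBilin Λ c (p j).1 (p j).2) y) hstep hsum
  -- … and the limit is the jet of the limit member (jet continuity in the parameters)
  have hcont := stub_kerrSchildJets.1 Λ c y pinf m hradinf
  have hLm' : Tendsto (fun j ↦ iteratedFDeriv ℝ m (boostedKerrBilin Λ c (p j).1 (p j).2) y) atTop
      (𝓝 (iteratedFDeriv ℝ m (boostedKerrBilin Λ c pinf.1 pinf.2) y)) :=
    hcont.tendsto.comp hp
  have hEq : Lm = iteratedFDeriv ℝ m (boostedKerrBilin Λ c pinf.1 pinf.2) y := tendsto_nhds_unique hLm hLm'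
  rw [← hEq]
  exact hbound n

-- long statements; the algebraic / operator-norm instance paths on `E4 →L[ℝ] E4 →L[ℝ] ℝ` unify slowly
set_option synthInstance.maxHeartbeats 200000 in
set_option maxHeartbeats 1600000 in
/-- **Fixed slab, pointwise**: under the hypotheses of `freezing_jet_sub_limit_le`, for `τ ∈ Iₙ`, `y`
in the slab of radius `ρ` at time `τ` and `m ≤ k`,
`‖Dᵐ(Ψ^*g − g_{p∞})(y)‖ ≤ eₙ + 2Tₙ ≤ 3Tₙ`. [cite: KerrSchild1965, §2] -/
theorem freezing_fixed_pointwise (hΨ : ContMDiff 𝓘(ℝ, E4) (𝓡 4) ∞ Ψ) (R : ℝ → ℝ) {k m : ℕ}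
    (hm : m ≤ k) (ρ : ℝ) (n₀ : ℕ) {p : ℕ → ℝ × ℝ} {pinf : ℝ × ℝ}
    (hdisc : ∀ n, (p n).2 ^ 2 ≤ a' ^ 2 + max (Kerr.rPlus M' a') 0 ^ 2)
    (hdisc' : pinf.2 ^ 2 ≤ a' ^ 2 + max (Kerr.rPlus M' a') 0 ^ 2)
    (hp : Tendsto p atTop (𝓝 pinf)) (hfin : ∀ n, Ew⟦R, k, ρ, n₀, n, p n⟧ ≠ ⊤)
    (htail : Tendsto (fun n ↦ ∑' j, Ew⟦R, k, ρ, n₀, j + n, p (j + n)⟧) atTop (𝓝 0))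
    {n : ℕ} {τ : ℝ} (hτ : τ ∈ Set.Icc ((2 : ℝ) ^ (n₀ + n)) ((2 : ℝ) ^ (n₀ + n + 1))) {y : E4}
    (hy : y ∈ Subtype.val '' (Bw⟦pinf⟧).truncTimeSlab ρ τ) :
    ‖iteratedFDeriv ℝ m (𝓢.deviationExtend Bw⟦pinf⟧ Ψ) y‖ₑ ≤
      3 * ∑' j, Ew⟦R, k, ρ, n₀, j + n, p (j + n)⟧ := by
  have hyU : y ∈ (boostedKerrExterior Λ c M' a' : Set E4) := ((freezing_mem_slab_iff Λ c M' a' _ ρ τ y).1 hy).1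
  have hrad : 0 < Kerr.radius (p n).2 (poincareInv Λ c y) := freezing_radius_pos_boosted Λ c (hdisc n) hyU
  have hradinf : 0 < Kerr.radius pinf.2 (poincareInv Λ c y) := freezing_radius_pos_boosted Λ c hdisc' hyU
  have hyn : y ∈ Subtype.val '' (Bw⟦p n⟧).truncTimeSlab ρ τ := by
    rw [freezing_mem_slab_iff] at hy ⊢; exact hy
  have h1 := freezing_enorm_iteratedFDeriv_dev_le (𝓢 := 𝓢) (boostedKerrBackground Λ c M' a') Ψ
    (boostedKerrBilin Λ c (p n).1 (p n).2) (boostedKerrBilin Λ c pinf.1 pinf.2) hΨ hyU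
    (freezing_contDiffAt_boosted Λ c (p n) hrad) (freezing_contDiffAt_boosted Λ c pinf hradinf) m
  have h2 : iteratedFDeriv ℝ m (fun z ↦ boostedKerrBilin Λ c (p n).1 (p n).2 z -
      boostedKerrBilin Λ c pinf.1 pinf.2 z) y =
      iteratedFDeriv ℝ m (boostedKerrBilin Λ c (p n).1 (p n).2) y -
        iteratedFDeriv ℝ m (boostedKerrBilin Λ c pinf.1 pinf.2) y :=
    iteratedFDeriv_sub_apply ((freezing_contDiffAt_boosted Λ c (p n) hrad).of_le (mod_cast le_top))
      ((freezing_contDiffAt_boosted Λ c pinf hradinf).of_le (mod_cast le_top))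
  rw [h2] at h1
  have h3 := freezing_jet_sub_limit_le Λ c M' a' Ψ hΨ R hm ρ n₀ hdisc hdisc' hp hfin htail hy n
  have h4 := freezing_window_pointwise_fixed Λ c M' a' Ψ R hm ρ n₀ n (p n) hτ hyn
  have h5 := freezing_le_tail (fun j ↦ Ew⟦R, k, ρ, n₀, j, p j⟧) n
  calc ‖iteratedFDeriv ℝ m (𝓢.deviationExtend Bw⟦pinf⟧ Ψ) y‖ₑ
      ≤ _ := h1
    _ ≤ Ew⟦R, k, ρ, n₀, n, p n⟧ + 2 * ∑' j, Ew⟦R, k, ρ, n₀, j + n, p (j + n)⟧ := add_le_add h4 h3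
    _ ≤ (∑' j, Ew⟦R, k, ρ, n₀, j + n, p (j + n)⟧) + 2 * ∑' j, Ew⟦R, k, ρ, n₀, j + n, p (j + n)⟧ :=
        add_le_add h5 le_rfl
    _ = 3 * ∑' j, Ew⟦R, k, ρ, n₀, j + n, p (j + n)⟧ := by ring

-- long statements; the algebraic / operator-norm instance paths on `E4 →L[ℝ] E4 →L[ℝ] ℝ` unify slowly
set_option synthInstance.maxHeartbeats 200000 in
set_option maxHeartbeats 1600000 in
/-- **Growing slab, far field, pointwise**: let `(C, R₀)` be far-field decay constants for every
`m ≤ k` on the window (`freezing_decay_uniform`), `0 < R₀`, and `s² ≥ R₀² + (|χ|/m₀)²`. If the window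
members `pₙ` (all in the window, as is `p∞`) have finite window errors, then for `τ ∈ Iₙ`, a point `y`
of the growing slab `{t* = τ, r_{a'} ≤ R τ}` with rest-frame spatial norm `≥ s`, and `m ≤ k`,
`‖Dᵐ(Ψ^*g − g_{p∞})(y)‖ ≤ eₙ + 2C/R₀`. [cite: KerrSchild1965, §3] -/
theorem freezing_far_pointwise (hΨ : ContMDiff 𝓘(ℝ, E4) (𝓡 4) ∞ Ψ) {m₀ χ : ℝ} (hm₀ : 0 < m₀)
    (R : ℝ → ℝ) {k m : ℕ} (hm : m ≤ k) (ρ : ℝ) (n₀ : ℕ) {p : ℕ → ℝ × ℝ} {pinf : ℝ × ℝ}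
    (hpW : ∀ n, p n ∈ {q : ℝ × ℝ | m₀ ≤ q.1 ∧ q.1 ≤ m₀⁻¹ ∧ |q.2| ≤ χ * q.1})
    (hpinfW : pinf ∈ {q : ℝ × ℝ | m₀ ≤ q.1 ∧ q.1 ≤ m₀⁻¹ ∧ |q.2| ≤ χ * q.1})
    {C R₀ s : ℝ} (hR₀ : 0 < R₀)
    (hdecay : ∀ m ≤ k, ∀ (M a : ℝ), m₀ ≤ M → M ≤ m₀⁻¹ → |a| ≤ χ * M → ∀ x : E4,
      R₀ ≤ Kerr.radius a (poincareInv Λ c x) →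
      ‖iteratedFDeriv ℝ m (fun y ↦ boostedKerrBilin Λ c M a y - Minkowski.bilin) x‖ ≤
        C / Kerr.radius a (poincareInv Λ c x))
    (hs : R₀ ^ 2 + (|χ| * m₀⁻¹) ^ 2 ≤ s ^ 2) (hs0 : 0 ≤ s)
    {n : ℕ} {τ : ℝ} (hτ : τ ∈ Set.Icc ((2 : ℝ) ^ (n₀ + n)) ((2 : ℝ) ^ (n₀ + n + 1))) {y : E4}
    (hy : y ∈ Subtype.val '' (Bw⟦pinf⟧).truncTimeSlab (R τ) τ)
    (hfar : s ≤ E4.spatialNorm (poincareInv Λ c y)) :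
    ‖iteratedFDeriv ℝ m (𝓢.deviationExtend Bw⟦pinf⟧ Ψ) y‖ₑ ≤
      Ew⟦R, k, ρ, n₀, n, p n⟧ + 2 * ENNReal.ofReal (C / R₀) := by
  have hyU : y ∈ (boostedKerrExterior Λ c M' a' : Set E4) :=
    ((freezing_mem_slab_iff Λ c M' a' _ (R τ) τ y).1 hy).1
  -- every window member has radius `≥ R₀` at `y`
  have hradW : ∀ q ∈ {q : ℝ × ℝ | m₀ ≤ q.1 ∧ q.1 ≤ m₀⁻¹ ∧ |q.2| ≤ χ * q.1},
      R₀ ≤ Kerr.radius q.2 (poincareInv Λ c y) := by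
    intro q hq
    refine freezing_le_radius_of_sq_le hR₀.le ?_
    have ha : |q.2| ≤ |χ| * m₀⁻¹ := freezing_abs_le_of_window hm₀ hq
    have ha2 : q.2 ^ 2 ≤ (|χ| * m₀⁻¹) ^ 2 := by
      rw [← sq_abs q.2]; exact pow_le_pow_left₀ (abs_nonneg _) ha 2
    have hs2 : s ^ 2 ≤ E4.spatialNorm (poincareInv Λ c y) ^ 2 := pow_le_pow_left₀ hs0 hfar 2
    linarith
  have hrad : 0 < Kerr.radius (p n).2 (poincareInv Λ c y) := hR₀.trans_le (hradW (p n) (hpW n))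
  have hradinf : 0 < Kerr.radius pinf.2 (poincareInv Λ c y) := hR₀.trans_le (hradW pinf hpinfW)
  have hyn : y ∈ Subtype.val '' (Bw⟦p n⟧).truncTimeSlab (R τ) τ := by
    rw [freezing_mem_slab_iff] at hy ⊢; exact hy
  -- decay bounds for the two members at `y`, in `ℝ≥0∞`
  have hdec : ∀ q ∈ {q : ℝ × ℝ | m₀ ≤ q.1 ∧ q.1 ≤ m₀⁻¹ ∧ |q.2| ≤ χ * q.1},
      ‖iteratedFDeriv ℝ m (fun z ↦ boostedKerrBilin Λ c q.1 q.2 z - Minkowski.bilin) y‖ₑ ≤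
        ENNReal.ofReal (C / R₀) := by
    intro q hq
    have hr := hradW q hq
    have h := hdecay m hm q.1 q.2 hq.1 hq.2.1 hq.2.2 y hr
    rw [← ofReal_norm]
    refine ENNReal.ofReal_le_ofReal (h.trans ?_)
    have hC : 0 ≤ C := by
      have := (norm_nonneg _).trans h
      exact (div_nonneg_iff.1 this).elim (fun h' ↦ h'.1) fun h' ↦ by
        exfalso; linarith [hR₀.trans_le hr, h'.2]
    exact div_le_div_of_nonneg_left hC hR₀ hr
  -- smooth triangle inequality and the identity `g_p − g_q = (g_p − η) − (g_q − η)`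
  have h1 := freezing_enorm_iteratedFDeriv_dev_le (𝓢 := 𝓢) (boostedKerrBackground Λ c M' a') Ψ
    (boostedKerrBilin Λ c (p n).1 (p n).2) (boostedKerrBilin Λ c pinf.1 pinf.2) hΨ hyU
    (freezing_contDiffAt_boosted Λ c (p n) hrad) (freezing_contDiffAt_boosted Λ c pinf hradinf) m
  have hcp : ContDiffAt ℝ m (fun z ↦ boostedKerrBilin Λ c (p n).1 (p n).2 z - Minkowski.bilin) y :=
    ((freezing_contDiffAt_boosted Λ c (p n) hrad).of_le (mod_cast le_top)).sub contDiffAt_const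
  have hcq : ContDiffAt ℝ m (fun z ↦ boostedKerrBilin Λ c pinf.1 pinf.2 z - Minkowski.bilin) y :=
    ((freezing_contDiffAt_boosted Λ c pinf hradinf).of_le (mod_cast le_top)).sub contDiffAt_const
  have h2 : iteratedFDeriv ℝ m (fun z ↦ boostedKerrBilin Λ c (p n).1 (p n).2 z -
      boostedKerrBilin Λ c pinf.1 pinf.2 z) y =
      iteratedFDeriv ℝ m (fun z ↦ boostedKerrBilin Λ c (p n).1 (p n).2 z - Minkowski.bilin) y -
        iteratedFDeriv ℝ m (fun z ↦ boostedKerrBilin Λ c pinf.1 pinf.2 z - Minkowski.bilin) y := by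
    rw [← iteratedFDeriv_sub_apply hcp hcq]
    congr 1
    funext z
    simp only [Pi.sub_apply]
    abel
  rw [h2] at h1
  have h4 := freezing_window_pointwise_growing Λ c M' a' Ψ R hm ρ n₀ n (p n) hτ hyn
  calc ‖iteratedFDeriv ℝ m (𝓢.deviationExtend Bw⟦pinf⟧ Ψ) y‖ₑ ≤ _ := h1
    _ ≤ Ew⟦R, k, ρ, n₀, n, p n⟧ + (ENNReal.ofReal (C / R₀) + ENNReal.ofReal (C / R₀)) := by
        refine add_le_add h4 (enorm_sub_le.trans (add_le_add (hdec (p n) (hpW n)) (hdec pinf hpinfW)))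
    _ = Ew⟦R, k, ρ, n₀, n, p n⟧ + 2 * ENNReal.ofReal (C / R₀) := by rw [two_mul]

end Instance

/-- **Part D, registered form** (`freezingD_abs_le_of_window`, the name under which this helper file is
attached to the crux item): window members have `|a| ≤ |χ|/m₀`. [folklore] -/
theorem freezingD_abs_le_of_window : ∀ (m₀ χ : ℝ), 0 < m₀ → ∀ (q : ℝ × ℝ), m₀ ≤ q.1 → q.1 ≤ m₀⁻¹ → |q.2| ≤ χ * q.1 → |q.2| ≤ |χ| * m₀⁻¹ :=
  fun _ _ hm₀ _ h1 h2 h3 ↦ freezing_abs_le_of_window hm₀ ⟨h1, h2, h3⟩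

end Summit.FinalStateConjecture.FinalStateConjecture.Theorems

end
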